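import Summits.HodgeConjecture.HodgeConjecture.Theorems.Ring2WeilCoverageCMFieldAllPrimesI
import Mathlib.GroupTheory.Perm.Cycle.Type
import HarnessLib

/-!
# Weil-type components over quartic CM fields, IX (part J): `[ℓ] = [1]` for every prime `ℓ ≡ 1 (mod 5)` in
# `ℚ(ζ₅)` — the complete prime classification `[ℓ] ≠ [1] ⟺ ℓ ≢ 1 (mod 5), ℓ ≠ 5`

research route conditional on HC_CM; not a corollary; Q11.4-sentence-2 already refuted in dim ≥ 3. Cell
`pub-hodge-ring2`, seat `ring2-b03` (gen 51); conclusion of part I (`Ring2WeilCoverageCMFieldAllPrimesI`: the Thue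
box, the norm form `Q = P₀² + 5(P₁² + P₂² + P₃²)` of `E = ℚ(ζ₅)` on `z = (c₀ + c₁φ) + (c₂ + c₃φ)η`, its divisibility,
bound, nonvanishing, and the peeling tools). Here: §1 the numerals `[41] = [61] = [71] = [101] = [1]` (with gen 49's
`[11] = [31] = [1]`: every prime `p ≡ 1 (mod 5)` below `119`); §2 a degree-one place of `E` over `ℓ ≡ 1 (mod 5)`
(`e = ζ - ζ⁴` for `ζ ∈ 𝔽_ℓ^×` of order `5`: `e⁴ + 5e² + 5 = Φ₅(ζ) + (…)(ζ⁵ - 1) = 0`); §3 the PEELING induction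
(from `[ε·k·ℓ] = [1]`, `ε ∈ {1, 2}`, `k ≤ 118`: odd primes `q ≢ 0, 1 (mod 5)` occur in `k` to even powers — else
part A's `[q·w] ≠ [1]` —, `[5] = [1]`, `[p] = [1]` for `p ≡ 1 (mod 5)` by §1, and a left-over `[2ℓ] = [1]`,
`2ℓ ≡ 2 (mod 5)`, contradicts gen 47's `(√5)`-adic residue theorem); §4 **`[ℓ] = [1]` for EVERY prime
`ℓ ≡ 1 (mod 5)`** (`z·τz` is an explicit norm witness for `Q = kℓ`, `τ` the generator of `Gal(E/ℚ)`), and the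
**COMPLETE PRIME CLASSIFICATION for `ℚ(ζ₅)`: `[ℓ] ≠ [1] ⟺ ℓ % 5 ≠ 1 ∧ ℓ ≠ 5`** — the Weil-type component `W8.E.[ℓ]`
of abelian eightfolds with `ℚ(ζ₅)`-signature `(2,2;2,2)` is the split one exactly for `ℓ = 5, 11, 31, 41, 61, …`.
With parts E/F the prime classification is now complete for FIVE of the seven census fields (all the Galois
ones but `ℚ(√-(2+√2))`, whose split side `ℓ ≡ 1, 7 (mod 16)` would need the analogous argument with `ζ₁₆` in
place of `ζ₅`). No named fact, no definition, no `sorry`; nothing about the Hodge conjecture is asserted.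
References: [Deligne1982HodgeCycles] §4 p. 30 (1), Cor. 4.2, Lemma 4.6; [Landherr1936HermitianForms]. -/

noncomputable section

set_option linter.dupNamespace false

open Polynomial

namespace Summit.HodgeConjecture.HodgeConjecture.Ring2.WeilCoverageCM

open Literature.AlgebraicGeometry.Deligne1982
open Literature.AlgebraicGeometry.HodgeTheory (splitDiscriminantClassCM)

/-! ### §0 A degree-one place of `ℚ(ζ₅)` over `ℓ ≡ 1 (mod 5)` -/

/-- A root of `T⁴ + 5T² + 5` in `𝔽_ℓ` for `ℓ ≡ 1 (mod 5)`: `e = ζ - ζ⁴` for `ζ` of order `5` (Cauchy), by the identity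
`e⁴ + 5e² + 5 = Φ₅(ζ) + (ζ¹¹ - 4ζ⁸ + ζ⁶ + 6ζ⁵ + ζ³ - 4ζ² + ζ - 4)(ζ⁵ - 1)`. [folklore] -/
theorem exists_root_cmPoly_zeta5 {ℓ : ℕ} [Fact ℓ.Prime] (h5 : ℓ % 5 = 1) :
    ∃ e : ZMod ℓ, e ^ 4 + 5 * e ^ 2 + 5 = 0 := by
  haveI : Fact (Nat.Prime 5) := ⟨by norm_num⟩
  have hcard : 5 ∣ Fintype.card (ZMod ℓ)ˣ := by
    rw [ZMod.card_units ℓ]; have := (Fact.out : ℓ.Prime).two_le; omega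
  obtain ⟨g, hg⟩ := exists_prime_orderOf_dvd_card 5 hcard
  have hg5 : ((g : ZMod ℓ)) ^ 5 = 1 := by
    rw [← Units.val_pow_eq_pow_val, ← hg, pow_orderOf_eq_one, Units.val_one]
  have hg1 : (g : ZMod ℓ) ≠ 1 := by
    intro h
    have : g = 1 := Units.ext h
    rw [this, orderOf_one] at hg
    norm_num at hg
  have hΦ : (g : ZMod ℓ) ^ 4 + (g : ZMod ℓ) ^ 3 + (g : ZMod ℓ) ^ 2 + g + 1 = 0 := by
    have : ((g : ZMod ℓ) - 1) * ((g : ZMod ℓ) ^ 4 + (g : ZMod ℓ) ^ 3 + (g : ZMod ℓ) ^ 2 + g + 1) = 0 := by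
      linear_combination hg5
    exact (mul_eq_zero.1 this).resolve_left (sub_ne_zero.2 hg1)
  refine ⟨(g : ZMod ℓ) - (g : ZMod ℓ) ^ 4, ?_⟩
  linear_combination hΦ + ((g : ZMod ℓ) ^ 11 - 4 * (g : ZMod ℓ) ^ 8 + (g : ZMod ℓ) ^ 6 + 6 * (g : ZMod ℓ) ^ 5
    + (g : ZMod ℓ) ^ 3 - 4 * (g : ZMod ℓ) ^ 2 + g - 4) * hg5

section Zeta5

variable {R : Polynomial ℤ} (hR : R = X ^ 2 + C 5 * X + C 5) [Fact (Irreducible (realPolyQ R))]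
include hR

/-! ### §1 The numerals `41, 61, 71, 101` -/

/-- **`[41] = [1]` for `ℚ(ζ₅)`**: `41 = (1 + 2σ)² - σ(-8 - 2σ)²`. [cite: Deligne1982HodgeCycles, §4 p. 30 (1) and Cor. 4.2] -/
theorem zeta5_mk_fortyOne_eq_splitDiscriminantClassCM (u : (realField R)ˣ)
    (hu : (u : realField R) = AdjoinRoot.of (realPolyQ R) 41) :
    (QuotientGroup.mk u : cmNormResidueGroup R) = splitDiscriminantClassCM R 2 :=
  mk_eq_splitDiscriminantClassCM_two_of_coords_of_pos hR (by norm_num) (by norm_num) disc_not_sq_five_five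
    41 1 2 (-8) (-2) 1 one_ne_zero (by norm_num) (by norm_num) u hu

/-- **`[61] = [1]` for `ℚ(ζ₅)`**: `61 = (1 + 2σ)² - σ(-12 - 4σ)²`. [cite: Deligne1982HodgeCycles, §4 p. 30 (1) and Cor. 4.2] -/
theorem zeta5_mk_sixtyOne_eq_splitDiscriminantClassCM (u : (realField R)ˣ)
    (hu : (u : realField R) = AdjoinRoot.of (realPolyQ R) 61) :
    (QuotientGroup.mk u : cmNormResidueGroup R) = splitDiscriminantClassCM R 2 :=
  mk_eq_splitDiscriminantClassCM_two_of_coords_of_pos hR (by norm_num) (by norm_num) disc_not_sq_five_five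
    61 1 2 (-12) (-4) 1 one_ne_zero (by norm_num) (by norm_num) u hu

/-- **`[71] = [1]` for `ℚ(ζ₅)`**: `71 = (4 + 2σ)² - σ(-14 - 5σ)²`. [cite: Deligne1982HodgeCycles, §4 p. 30 (1) and Cor. 4.2] -/
theorem zeta5_mk_seventyOne_eq_splitDiscriminantClassCM (u : (realField R)ˣ)
    (hu : (u : realField R) = AdjoinRoot.of (realPolyQ R) 71) :
    (QuotientGroup.mk u : cmNormResidueGroup R) = splitDiscriminantClassCM R 2 :=
  mk_eq_splitDiscriminantClassCM_two_of_coords_of_pos hR (by norm_num) (by norm_num) disc_not_sq_five_five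
    71 4 2 (-14) (-5) 1 one_ne_zero (by norm_num) (by norm_num) u hu

/-- **`[101] = [1]` for `ℚ(ζ₅)`**: `101 = (19 + 8σ)² - σ(-8 - 2σ)²`. [cite: Deligne1982HodgeCycles, §4 p. 30 (1) and Cor. 4.2] -/
theorem zeta5_mk_oneHundredOne_eq_splitDiscriminantClassCM (u : (realField R)ˣ)
    (hu : (u : realField R) = AdjoinRoot.of (realPolyQ R) 101) :
    (QuotientGroup.mk u : cmNormResidueGroup R) = splitDiscriminantClassCM R 2 :=
  mk_eq_splitDiscriminantClassCM_two_of_coords_of_pos hR (by norm_num) (by norm_num) disc_not_sq_five_five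
    101 19 8 (-8) (-2) 1 one_ne_zero (by norm_num) (by norm_num) u hu

/-- **Every prime `p ≡ 1 (mod 5)` below `119` is split**: `p ∈ {11, 31, 41, 61, 71, 101}` (gen 49 and §1).
[cite: Deligne1982HodgeCycles, §4 p. 30 (1) and Cor. 4.2] -/
theorem zeta5_mk_prime_eq_splitDiscriminantClassCM_of_le (p : ℕ) (hp : p.Prime) (h5 : p % 5 = 1) (h119 : p ≤ 118)
    (v : (realField R)ˣ) (hv : (v : realField R) = p) :
    (QuotientGroup.mk v : cmNormResidueGroup R) = splitDiscriminantClassCM R 2 := by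
  have hcases : p = 11 ∨ p = 31 ∨ p = 41 ∨ p = 61 ∨ p = 71 ∨ p = 101 := by
    interval_cases p <;> first | omega | (exfalso; exact absurd hp (by norm_num))
  have e : ∀ n : ℕ, (v : realField R) = n → (v : realField R) = AdjoinRoot.of (realPolyQ R) n := fun n h => by
    rw [h]; exact (map_natCast (AdjoinRoot.of (realPolyQ R)) n).symm
  rcases hcases with rfl | rfl | rfl | rfl | rfl | rfl
  · exact zeta5_mk_eleven_eq_splitDiscriminantClassCM hR v (by rw [e 11 hv]; norm_num)
  · exact zeta5_mk_thirtyOne_eq_splitDiscriminantClassCM hR v (by rw [e 31 hv]; norm_num)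
  · exact zeta5_mk_fortyOne_eq_splitDiscriminantClassCM hR v (by rw [e 41 hv]; norm_num)
  · exact zeta5_mk_sixtyOne_eq_splitDiscriminantClassCM hR v (by rw [e 61 hv]; norm_num)
  · exact zeta5_mk_seventyOne_eq_splitDiscriminantClassCM hR v (by rw [e 71 hv]; norm_num)
  · exact zeta5_mk_oneHundredOne_eq_splitDiscriminantClassCM hR v (by rw [e 101 hv]; norm_num)

/-! ### §2 Peeling: from `[ε·k·ℓ] = [1]` down to `[ℓ] = [1]` -/

/-- **Peeling.** `ℓ ≡ 1 (mod 5)` prime; if `[ε·k·ℓ] = [1]` with `ε ∈ {1, 2}`, `1 ≤ k`, and every prime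
`p ≡ 1 (mod 5)` dividing `k` has `[p] = [1]`, then `[ℓ] = [1]`: strip `5`'s (`[5] = [1]`), such `p`'s, squares of
the remaining odd primes `q ≢ 0, 1 (mod 5)` (an odd power is impossible: part A's `[q·w] ≠ [1]`), and powers of
`2` (a single `2` is moved into `ε`; `[2ℓ] = [1]` is impossible: `2ℓ ≡ 2 (mod 5)`, gen 47).
[cite: Deligne1982HodgeCycles, §4 p. 30 (1) and Cor. 4.2] -/
theorem zeta5_peel (ℓ : ℕ) (hℓ : ℓ.Prime) (hℓ5 : ℓ % 5 = 1) (k : ℕ) :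
    1 ≤ k →
    (∀ p : ℕ, p.Prime → p ∣ k → p % 5 = 1 → ∀ v : (realField R)ˣ, (v : realField R) = p →
      (QuotientGroup.mk v : cmNormResidueGroup R) = splitDiscriminantClassCM R 2) →
    ∀ ε : ℕ, (ε = 1 ∨ ε = 2) →
    (∀ v : (realField R)ˣ, (v : realField R) = ((ε * k * ℓ : ℕ) : realField R) →
      (QuotientGroup.mk v : cmNormResidueGroup R) = splitDiscriminantClassCM R 2) →
    ∀ v : (realField R)ˣ, (v : realField R) = ℓ →
      (QuotientGroup.mk v : cmNormResidueGroup R) = splitDiscriminantClassCM R 2 := by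
  haveI := fact_irreducible_cmPolyQ_of_pos hR (by norm_num) (by norm_num) disc_not_sq_five_five
  have hℓ1 : 1 ≤ ℓ := hℓ.one_lt.le
  induction k using Nat.strong_induction_on with
  | _ k ih =>
  intro hk hp ε hε hsplit v hv
  by_cases hk1 : k = 1
  · subst hk1
    rcases hε with rfl | rfl
    · exact hsplit v (by rw [hv]; push_cast; ring)
    · -- `[2ℓ] = [1]` is impossible
      exfalso
      have hne := zeta5_mk_ne_splitDiscriminantClassCM_of_residue hR ((2 * ℓ : ℕ) : ℤ)
        (Or.inl (by
          have h := ZMod.natCast_mod (2 * ℓ) 5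
          rw [show 2 * ℓ % 5 = 2 by omega] at h
          push_cast at h ⊢
          exact h.symm))
        (Units.mk0 (((2 * 1 * ℓ : ℕ)) : realField R) (natCast_ne_zero_realField _ (by omega)))
        (by rw [Units.val_mk0]; push_cast; simp only [map_mul, map_natCast, map_ofNat])
      exact hne (hsplit _ (Units.val_mk0 _))
  · -- `k ≥ 2`: peel the least prime factor `q`
    have hk2 : 2 ≤ k := by omega
    set q := k.minFac with hqdef
    have hq : q.Prime := Nat.minFac_prime hk1
    obtain ⟨k₁, hk₁⟩ : q ∣ k := Nat.minFac_dvd k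
    have hk₁pos : 1 ≤ k₁ := by
      rcases Nat.eq_zero_or_pos k₁ with h | h
      · rw [h, mul_zero] at hk₁; omega
      · exact h
    have hq2 : 2 ≤ q := hq.two_le
    have hk₁lt : k₁ < k := by
      rw [hk₁]; nlinarith
    have hp₁ : ∀ p : ℕ, p.Prime → p ∣ k₁ → p % 5 = 1 → ∀ v : (realField R)ˣ, (v : realField R) = p →
        (QuotientGroup.mk v : cmNormResidueGroup R) = splitDiscriminantClassCM R 2 :=
      fun p hp' hpd => hp p hp' (hk₁ ▸ Dvd.dvd.mul_left hpd q)
    -- the factorisation `ε k ℓ = q · (ε k₁ ℓ)`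
    have hfac : ε * k * ℓ = q * (ε * k₁ * ℓ) := by rw [hk₁]; ring
    -- case A: `[q] = [1]` is known (`q = 5` or `q ≡ 1 (mod 5)`): strip it
    have caseA : (∀ w : (realField R)ˣ, (w : realField R) = q →
        (QuotientGroup.mk w : cmNormResidueGroup R) = splitDiscriminantClassCM R 2) →
        (QuotientGroup.mk v : cmNormResidueGroup R) = splitDiscriminantClassCM R 2 := by
      intro hsq
      refine ih k₁ hk₁lt hk₁pos hp₁ ε hε ?_ v hv
      intro w hw
      exact natCast_split_of_mul_of_left q (ε * k₁ * ℓ) (by omega) hsq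
        (fun w' hw' => hsplit w' (by rw [hw', hfac])) w hw
    -- case B: `q² ∣ k`: strip the square
    have caseB : q ∣ k₁ → (QuotientGroup.mk v : cmNormResidueGroup R) = splitDiscriminantClassCM R 2 := by
      rintro ⟨k₂, hk₂⟩
      have hk₂pos : 1 ≤ k₂ := by
        rcases Nat.eq_zero_or_pos k₂ with h | h
        · rw [h, mul_zero] at hk₂; omega
        · exact h
      have hk₂lt : k₂ < k := by rw [hk₁, hk₂]; nlinarith
      have hp₂ : ∀ p : ℕ, p.Prime → p ∣ k₂ → p % 5 = 1 → ∀ v : (realField R)ˣ, (v : realField R) = p →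
          (QuotientGroup.mk v : cmNormResidueGroup R) = splitDiscriminantClassCM R 2 :=
        fun p hp' hpd => hp₁ p hp' (hk₂ ▸ Dvd.dvd.mul_left hpd q)
      refine ih k₂ hk₂lt hk₂pos hp₂ ε hε ?_ v hv
      intro w hw
      refine natCast_split_of_sq_mul q (ε * k₂ * ℓ) (by omega) (fun w' hw' => hsplit w' ?_) w hw
      rw [hw', hk₁, hk₂]; push_cast; ring
    by_cases hq5 : q = 5
    · exact caseA (fun w hw => zeta5_mk_five_eq_splitDiscriminantClassCM hR w
        (by rw [hw, hq5]; exact (map_natCast (AdjoinRoot.of (realPolyQ R)) 5).symm.trans (by norm_num)))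
    by_cases hq1 : q % 5 = 1
    · exact caseA (hp q hq ⟨k₁, hk₁⟩ hq1)
    by_cases hqk₁ : q ∣ k₁
    · exact caseB hqk₁
    by_cases hqtwo : q = 2
    · -- `k = 2 k₁`, `k₁` odd
      rcases hε with rfl | rfl
      · -- move the `2` into `ε`
        refine ih k₁ hk₁lt hk₁pos hp₁ 2 (Or.inr rfl) ?_ v hv
        intro w hw
        exact hsplit w (by rw [hw, hk₁, hqtwo]; push_cast; ring)
      · -- `2 · 2k₁ = 2²·k₁`: strip the square, back to `ε = 1`
        refine ih k₁ hk₁lt hk₁pos hp₁ 1 (Or.inl rfl) ?_ v hv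
        intro w hw
        refine natCast_split_of_sq_mul 2 (1 * k₁ * ℓ) (by norm_num) (fun w' hw' => hsplit w' ?_) w hw
        rw [hw', hk₁, hqtwo]; push_cast; ring
    · -- `q` odd, `q ≢ 0, 1 (mod 5)`, `q ∥ k`: impossible by the inert/split criteria of part A
      exfalso
      have hq0 : q % 5 ≠ 0 := fun h => by
        have : 5 ∣ q := Nat.dvd_of_mod_eq_zero h
        rcases (Nat.dvd_prime hq).1 this with h' | h' <;> omega
      have hq5' : q % 5 = 2 ∨ q % 5 = 3 ∨ q % 5 = 4 := by omega
      have hqℓ : ¬ q ∣ ℓ := fun h => by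
        rcases (Nat.dvd_prime hℓ).1 h with h' | h' <;> omega
      have hqε : ¬ q ∣ ε := by
        rcases hε with rfl | rfl
        · exact hq.not_dvd_one
        · intro h; have := Nat.le_of_dvd (by norm_num) h; omega
      have hndvd : ¬ (q : ℤ) ∣ ((ε * k₁ * ℓ : ℕ) : ℤ) := by
        intro h
        have h' : q ∣ ε * k₁ * ℓ := by exact_mod_cast h
        rcases (Nat.Prime.dvd_mul hq).1 h' with h'' | h''
        · rcases (Nat.Prime.dvd_mul hq).1 h'' with h3 | h3
          · exact hqε h3
          · exact hqk₁ h3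
        · exact hqℓ h''
      have hε1 : 1 ≤ ε := by rcases hε with rfl | rfl <;> norm_num
      have hprod : 1 ≤ ε * k * ℓ := by
        have := Nat.mul_le_mul (Nat.mul_le_mul hε1 hk) hℓ1
        simpa using this
      have hu := hsplit (Units.mk0 (((ε * k * ℓ : ℕ)) : realField R) (natCast_ne_zero_realField _ hprod))
        (Units.val_mk0 _)
      exact zeta5_mk_prime_mul_ne_splitDiscriminantClassCM_of_mod_five hR q hq hqtwo hq5'
        ((ε * k₁ * ℓ : ℕ) : ℤ) hndvd _
        (by rw [Units.val_mk0, hfac]; push_cast; simp only [map_mul, map_natCast]) hu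

/-! ### §3 The main theorem and the complete classification -/

/-- **`[ℓ] = [1]` for `E = ℚ(ζ₅)` and EVERY prime `ℓ ≡ 1 (mod 5)`**: a non-zero `z = (c₀ + c₁φ) + (c₂ + c₃φ)η` in
the Thue box dies at a degree-one place over `ℓ` (part I `box_four` with `f = φ ↦ -2 - e²`), so
`Q = Nm_{E/ℚ}(z) = kℓ` with `1 ≤ k ≤ 118` (bound `119m⁴ < 119ℓ`, nonvanishing); `Q = Nm_{E/F}(z·τz)` is exhibited by
the integer norm witness `(A, B, C, D)` (`A² - 5B² + 10CD - 25D² = Q`, `2AB - 5B² - C² + 10CD - 20D² = 0`), so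
`[kℓ] = [1]`; peel (§2) using the numerals for the primes `p ≡ 1 (mod 5)`, `p ≤ 118` (for `ℓ ≤ 118` the theorem is
itself one of those numerals). [cite: Deligne1982HodgeCycles, §4 p. 30 (1) and Cor. 4.2] [cite: Landherr1936HermitianForms] -/
theorem zeta5_mk_prime_eq_splitDiscriminantClassCM_of_mod_five_one (ℓ : ℕ) (hℓ : ℓ.Prime) (hℓ5 : ℓ % 5 = 1)
    (u : (realField R)ˣ) (hu : (u : realField R) = ℓ) :
    (QuotientGroup.mk u : cmNormResidueGroup R) = splitDiscriminantClassCM R 2 := by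
  haveI : Fact ℓ.Prime := ⟨hℓ⟩
  haveI := fact_irreducible_cmPolyQ_of_pos hR (by norm_num) (by norm_num) disc_not_sq_five_five
  by_cases hsmall : ℓ ≤ 118
  · exact zeta5_mk_prime_eq_splitDiscriminantClassCM_of_le hR ℓ hℓ hℓ5 hsmall u hu
  -- a degree-one place and the Thue box
  obtain ⟨e, he⟩ := exists_root_cmPoly_zeta5 (ℓ := ℓ) hℓ5
  obtain ⟨m, hm, c₀, c₁, c₂, c₃, hne, h₀, h₁, h₂, h₃, hL⟩ := box_four (ℓ := ℓ) (-2 - e ^ 2) e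
  -- `Q = kℓ`
  have hQ0 := zeta5_normForm_zmod_eq_zero e he c₀ c₁ c₂ c₃ (by linear_combination hL)
  rw [ZMod.intCast_zmod_eq_zero_iff_dvd] at hQ0
  obtain ⟨k, hk⟩ := hQ0
  have hQle := zeta5_normForm_le m c₀ c₁ c₂ c₃ h₀ h₁ h₂ h₃
  have hQne := zeta5_normForm_ne_zero c₀ c₁ c₂ c₃ hne
  have hQnn : (0 : ℤ) ≤ (c₀ ^ 2 + c₀ * c₁ - c₁ ^ 2) ^ 2 + 5 * ((c₁ * c₂ - c₀ * c₃) ^ 2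
      + (c₁ * c₃ - c₀ * c₃ - c₀ * c₂) ^ 2 + (c₃ ^ 2 - c₂ * c₃ - c₂ ^ 2) ^ 2) := by positivity
  have hm4 : ((m : ℤ)) ^ 4 < ℓ := by exact_mod_cast hm
  have hℓpos : (0 : ℤ) < ℓ := by exact_mod_cast hℓ.pos
  have hk1 : 1 ≤ k := by
    by_contra h
    rw [not_le] at h
    have : (ℓ : ℤ) * k ≤ 0 := by nlinarith
    rw [← hk] at this
    exact hQne (le_antisymm this hQnn)
  have hk118 : k ≤ 118 := by
    by_contra h
    rw [not_le] at h
    have : (ℓ : ℤ) * 119 ≤ ℓ * k := by nlinarith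
    nlinarith
  obtain ⟨kn, rfl⟩ := Int.eq_ofNat_of_zero_le (by omega : (0 : ℤ) ≤ k)
  have hkn1 : 1 ≤ kn := by exact_mod_cast hk1
  have hkn : kn ≤ 118 := by exact_mod_cast hk118
  -- `[kℓ] = [1]` by the norm witness `z·τz`
  have hsplit : ∀ v : (realField R)ˣ, (v : realField R) = ((1 * kn * ℓ : ℕ) : realField R) →
      (QuotientGroup.mk v : cmNormResidueGroup R) = splitDiscriminantClassCM R 2 := by
    intro v hv
    refine mk_eq_splitDiscriminantClassCM_two_of_coords hR ((kn : ℤ) * ℓ)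
      ((-5) * c₃ ^ 2 + 5 * c₂ * c₃ + 5 * c₂ ^ 2 + (-1) * c₁ ^ 2 + c₀ * c₁ + c₀ ^ 2)
      ((-2) * c₃ ^ 2 + 2 * c₂ * c₃ + 2 * c₂ ^ 2)
      (2 * c₁ * c₃ + 4 * c₁ * c₂ + (-6) * c₀ * c₃ + (-2) * c₀ * c₂)
      (c₁ * c₃ + c₁ * c₂ + (-2) * c₀ * c₃ + (-1) * c₀ * c₂) 1 one_ne_zero ?_ (by ring) v ?_
    · rw [mul_comm (kn : ℤ) ℓ, ← hk]; ring
    · rw [hv]; push_cast; rw [map_mul, map_natCast, map_natCast]; ring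
  refine zeta5_peel hR ℓ hℓ hℓ5 kn hkn1 ?_ 1 (Or.inl rfl) hsplit u hu
  intro p hp hpk hp5 v hv
  exact zeta5_mk_prime_eq_splitDiscriminantClassCM_of_le hR p hp hp5 ((Nat.le_of_dvd (by omega) hpk).trans hkn) v hv

/-- **COMPLETE PRIME CLASSIFICATION for `E = ℚ(ζ₅)`: for every prime `ℓ`, `[ℓ] ≠ [1] ⟺ ℓ % 5 ≠ 1 ∧ ℓ ≠ 5`** —
the Weil-type component `W8.E.[ℓ]` is the SPLIT one exactly for `ℓ = 5` and the primes `ℓ ≡ 1 (mod 5)`, and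
NON-SPLIT for `ℓ = 2` (gen 47, `(√5)`-adic) and every prime `ℓ ≡ 2, 3, 4 (mod 5)` (part A).
[cite: Deligne1982HodgeCycles, §4 p. 30 (1) and Cor. 4.2] [cite: Landherr1936HermitianForms] -/
theorem zeta5_mk_prime_ne_splitDiscriminantClassCM_iff (ℓ : ℕ) (hℓ : ℓ.Prime) (u : (realField R)ˣ)
    (hu : (u : realField R) = ℓ) :
    (QuotientGroup.mk u : cmNormResidueGroup R) ≠ splitDiscriminantClassCM R 2 ↔ (ℓ % 5 ≠ 1 ∧ ℓ ≠ 5) := by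
  constructor
  · intro hne
    refine ⟨fun h1 => hne (zeta5_mk_prime_eq_splitDiscriminantClassCM_of_mod_five_one hR ℓ hℓ h1 u hu), ?_⟩
    rintro rfl
    exact hne (zeta5_mk_five_eq_splitDiscriminantClassCM hR u
      (by rw [hu]; exact (map_natCast (AdjoinRoot.of (realPolyQ R)) 5).symm.trans (by norm_num)))
  · rintro ⟨h1, h5⟩
    by_cases h2 : ℓ = 2
    · subst h2
      exact zeta5_mk_ne_splitDiscriminantClassCM_of_residue hR 2 (Or.inl rfl) u
        (by rw [hu]; exact (map_natCast (AdjoinRoot.of (realPolyQ R)) 2).symm.trans (by norm_num))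
    · have h0 : ℓ % 5 ≠ 0 := fun h => by
        have : 5 ∣ ℓ := Nat.dvd_of_mod_eq_zero h
        rcases (Nat.dvd_prime hℓ).1 this with h' | h' <;> omega
      exact zeta5_mk_prime_ne_splitDiscriminantClassCM_of_mod_five hR ℓ hℓ h2 (by omega) u hu

end Zeta5

end Summit.HodgeConjecture.HodgeConjecture.Ring2.WeilCoverageCM

end
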